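import Mathlib.Geometry.Manifold.ContMDiffMFDeriv
import Mathlib.Geometry.Manifold.MFDeriv.NormedSpace
import Literature.Geometry.Lorentzian.GeodesicConfinement
import Literature.Geometry.Lorentzian.Stationary

/-!
# `ErgoregionBombModT` — G5: the bounded-frequency null vectors over a compact set are compact
# (crux stmt-FinalStateConjecture-17838, line `SketchIdeator4` / zero-energy escape, stub G5)

Route `ZeroEnergyKerrOrBomb` of the Final State Conjecture, crux `ErgoregionBombModT`.  The
escape-modulo-the-stationary-flow lemma of the zero-energy escape engine transports the tangent
lifts of a confined null geodesic by flow isometries into the set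
`𝒦_B := {p ∈ TM | π p ∈ S, g(p, p) = 0, |dτ(p)| ≤ B}` of null vectors over a compact `S` whose
Killing-time frequency `dτ(p)` is bounded by `B`; to apply the uniform existence time for
geodesics (`exists_uniform_isGeodesicOn_of_isCompact`) one needs `𝒦_B` to lie in a *compact*
subset of `TM`.  This file proves that, for any `C^n` pseudo-Riemannian metric on a locally compact
manifold with finite-dimensional model and any function `τ` which is `C¹` on an open `W ⊇ S` with
`dτ(k) ≠ 0` for every non-zero null `k` over `W` (the level sets of `τ` are spacelike).

* `continuousOn_mvfderiv_tangentBundle` — for `τ` of class `C¹` on an open `W`, the frequency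
  function `p ↦ dτ_{π p}(p)` is continuous on `π ⁻¹' W ⊆ TM` (the fibre component of the
  continuous bundled derivative `tangentMapWithin`, read in the trivial tangent bundle of `ℝ`).
* `exists_isCompact_null_frequency_superset` — the general statement.  Proof, adapted from the
  tree lemma `PseudoRiemannianMetric.exists_isCompact_tangent_superset` (Lee, *Introduction to
  Riemannian Manifolds* (2018), proof of Lemma 6.19, for the `g`-short vectors of a Riemannian
  metric): over a compact neighbourhood `N ⊆ W` of a point of `S` inside a trivialising chart `e`
  of `TM`, the continuous function `(y, w) ↦ |g_y(e⁻¹ w, e⁻¹ w)| + |dτ_y(e⁻¹ w)|` is positive on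
  the compact set `N × {‖w‖ = 1}` (a unit chart vector is non-zero; if it is null its frequency is
  non-zero), hence `≥ m > 0` there; by homogeneity (`g` is quadratic, `dτ` linear in `w`) a null
  `p` over `N` with `|dτ(p)| ≤ B` has `m ‖e p‖ ≤ |dτ(p)| ≤ B`, so `p` lies in the compact set
  `e⁻¹ (N × closedBall 0 (B / m))`; finitely many such `N` cover `S`.
* `stub_nullFrequencyCompact` — the registered stub G5: the specialisation to the spacetime of a
  stationary asymptotically flat black hole (a `4`-manifold, locally compact by
  `Manifold.locallyCompact_of_finiteDimensional`).

References: J. M. Lee, *Introduction to Riemannian Manifolds*, 2nd ed., GTM 176 (2018),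
Lemma 6.19 (compactness of the unit sphere bundle over a compact set); B. O'Neill,
*Semi-Riemannian geometry*, Academic Press 1983, Ch. 5, Lemma 8; crux workfile
`Cruxes/ErgoregionBombModT/Ideas/zero-energy-escape.md`.
-/

noncomputable section

open Bundle Set Filter Metric
open Literature.Geometry.Lorentzian
open scoped Manifold ContDiff Topology

-- summit = problem name (D-0017)
set_option linter.dupNamespace false

namespace Summit.FinalStateConjecture.FinalStateConjecture.Theorems.ErgoregionBombModT

variable {E : Type*} [NormedAddCommGroup E] [NormedSpace ℝ E] {H : Type*} [TopologicalSpace H]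
  {I : ModelWithCorners ℝ E H} {M : Type*} [TopologicalSpace M] [ChartedSpace H M]
  [IsManifold I ∞ M] {n : ℕ∞ω}

/-- **Continuity of the frequency function.**  If `τ : M → ℝ` is `C¹` on an open set `W`, then
`p ↦ dτ_{π p}(p)` (`dτ = mvfderiv I τ`, the differential as a covector) is continuous on
`π ⁻¹' W ⊆ TM`: the bundled derivative `tangentMapWithin I 𝓘(ℝ, ℝ) τ W : TM → Tℝ` is continuous
on `π ⁻¹' W` (`ContMDiffOn.continuousOn_tangentMapWithin`), its fibre component is continuous
(`contMDiff_snd_tangentBundle_modelSpace`, `Tℝ = ℝ × ℝ`), and on the open `W` the derivative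
within `W` is the derivative. -/
theorem continuousOn_mvfderiv_tangentBundle {τ : M → ℝ} {W : Set M} (hW : IsOpen W)
    (hτ : ContMDiffOn I 𝓘(ℝ, ℝ) 1 τ W) :
    ContinuousOn (fun p : TangentBundle I M ↦ mvfderiv I τ p.proj p.2)
      (TotalSpace.proj ⁻¹' W) := by
  have h1 : ContinuousOn (tangentMapWithin I 𝓘(ℝ, ℝ) τ W)
      (TotalSpace.proj ⁻¹' W : Set (TangentBundle I M)) :=
    hτ.continuousOn_tangentMapWithin le_rfl hW.uniqueMDiffOn
  have h2 : Continuous fun q : TangentBundle 𝓘(ℝ, ℝ) ℝ ↦ (q.2 : ℝ) :=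
    (contMDiff_snd_tangentBundle_modelSpace (n := 0) ℝ 𝓘(ℝ, ℝ)).continuous
  refine (h2.comp_continuousOn h1).congr fun p hp ↦ ?_
  show mvfderiv I τ p.proj p.2 = mfderivWithin I 𝓘(ℝ, ℝ) τ W p.proj p.2
  rw [mfderivWithin_of_isOpen hW hp]
  rfl

/-- **Compactness of the bounded-frequency null vectors over a compact set.**  Let `g` be a `C^n`
pseudo-Riemannian metric on a locally compact manifold `M` with finite-dimensional model, `S ⊆ M`
compact, `W ⊇ S` open, `τ : M → ℝ` of class `C¹` on `W` with `dτ_x(k) ≠ 0` for every `x ∈ W`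
and every non-zero null vector `k` at `x`, and `B : ℝ`.  Then there is a compact `𝒦 ⊆ TM`
containing every null `p ∈ TM` over `S` with `|dτ(p)| ≤ B`.  Proof (the pattern of the tree lemma
`PseudoRiemannianMetric.exists_isCompact_tangent_superset`, Lee 2018, proof of Lemma 6.19): over
a compact neighbourhood `N ⊆ W` of a point of `S` inside a trivialising chart `e` of `TM`, the
continuous function `(y, w) ↦ |g_y(e⁻¹ w, e⁻¹ w)| + |dτ_y(e⁻¹ w)|` has a positive minimum `m` on
`N × {‖w‖ = 1}` (it does not vanish: `e⁻¹ w ≠ 0`, and a null `e⁻¹ w` has `dτ(e⁻¹ w) ≠ 0`), so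
by homogeneity a null `p` over `N` with `|dτ(p)| ≤ B` has `m ‖e p‖ ≤ B` and lies in the compact
set `e⁻¹ (N × closedBall 0 (B / m))`; finitely many such `N` cover `S`. -/
theorem exists_isCompact_null_frequency_superset [LocallyCompactSpace M] [FiniteDimensional ℝ E]
    (g : PseudoRiemannianMetric I n E (TangentSpace I : M → Type _))
    {S W : Set M} {τ : M → ℝ} (B : ℝ) (hS : IsCompact S) (hW : IsOpen W) (hSW : S ⊆ W)
    (hτ : ContMDiffOn I 𝓘(ℝ, ℝ) 1 τ W)
    (hnd : ∀ x ∈ W, ∀ k : TangentSpace I x, g.val x k k = 0 → k ≠ 0 → mvfderiv I τ x k ≠ 0) :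
    ∃ 𝒦 : Set (TangentBundle I M), IsCompact 𝒦 ∧
      ∀ p : TangentBundle I M, p.proj ∈ S → g.val p.proj p.2 p.2 = 0 →
        |mvfderiv I τ p.proj p.2| ≤ B → p ∈ 𝒦 := by
  have hF := g.continuous_val_tangentBundle
  have hG := continuousOn_mvfderiv_tangentBundle (I := I) hW hτ
  -- the local statement near each point of `S`
  have hloc : ∀ x ∈ S, ∃ N ∈ 𝓝 x, ∃ 𝒦 : Set (TangentBundle I M), IsCompact 𝒦 ∧
      ∀ p : TangentBundle I M, p.proj ∈ N → g.val p.proj p.2 p.2 = 0 →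
        |mvfderiv I τ p.proj p.2| ≤ B → p ∈ 𝒦 := by
    intro x hx
    set e := trivializationAt E (TangentSpace I : M → Type _) x with he_def
    have hxe : x ∈ e.baseSet := FiberBundle.mem_baseSet_trivializationAt' x
    obtain ⟨N, hN, hNe, hNc⟩ :=
      local_compact_nhds ((e.open_baseSet.inter hW).mem_nhds ⟨hxe, hSW hx⟩)
    have hNb : N ⊆ e.baseSet := hNe.trans inter_subset_left
    have hNW : N ⊆ W := hNe.trans inter_subset_right
    -- the length function and the frequency function in the chart `e`
    set Φ : M × E → ℝ := fun yw ↦ g.val yw.1 (e.symm yw.1 yw.2) (e.symm yw.1 yw.2) with hΦ_def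
    set Ψ : M × E → ℝ := fun yw ↦ mvfderiv I τ yw.1 (e.symm yw.1 yw.2) with hΨ_def
    have hΦc : ContinuousOn Φ (e.baseSet ×ˢ univ) := hF.comp_continuousOn e.continuousOn_symm
    have hΨc : ContinuousOn Ψ ((e.baseSet ∩ W) ×ˢ univ) := by
      have h1 : ContinuousOn
          (fun z : M × E ↦ (TotalSpace.mk' E z.1 (e.symm z.1 z.2) : TangentBundle I M))
          ((e.baseSet ∩ W) ×ˢ univ) :=
        e.continuousOn_symm.mono (prod_mono inter_subset_left (subset_univ _))
      have h2 : MapsTo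
          (fun z : M × E ↦ (TotalSpace.mk' E z.1 (e.symm z.1 z.2) : TangentBundle I M))
          ((e.baseSet ∩ W) ×ˢ univ) (TotalSpace.proj ⁻¹' W) := by
        intro z hz
        exact hz.1.2
      -- elaborate the composition without expected type, then unify (cheap defeq)
      have h3 := hG.comp h1 h2
      exact h3
    have hΦsmul : ∀ y ∈ e.baseSet, ∀ (c : ℝ) (w : E), Φ (y, c • w) = c ^ 2 * Φ (y, w) := by
      intro y hy c w
      simp only [hΦ_def]
      rw [← e.symmL_apply (R := ℝ) hy, ← e.symmL_apply (R := ℝ) hy, map_smul]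
      simp only [map_smul, smul_apply, smul_eq_mul]
      ring
    have hΨsmul : ∀ y ∈ e.baseSet, ∀ (c : ℝ) (w : E), Ψ (y, c • w) = c * Ψ (y, w) := by
      intro y hy c w
      simp only [hΨ_def]
      rw [← e.symmL_apply (R := ℝ) hy, ← e.symmL_apply (R := ℝ) hy, map_smul, map_smul,
        smul_eq_mul]
    -- a positive lower bound for `|Φ| + |Ψ|` on `N × sphere`
    obtain ⟨m, hm, hmΦΨ⟩ : ∃ m : ℝ, 0 < m ∧
        ∀ yw ∈ N ×ˢ sphere (0 : E) 1, m ≤ |Φ yw| + |Ψ yw| := by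
      by_cases hne : (N ×ˢ sphere (0 : E) 1).Nonempty
      · have hc : IsCompact (N ×ˢ sphere (0 : E) 1) := hNc.prod (isCompact_sphere 0 1)
        have hcont : ContinuousOn (fun yw ↦ |Φ yw| + |Ψ yw|) (N ×ˢ sphere (0 : E) 1) :=
          ((hΦc.mono (prod_mono hNb (subset_univ _))).abs).add
            ((hΨc.mono (prod_mono hNe (subset_univ _))).abs)
        obtain ⟨yw₀, hyw₀, hmin⟩ := hc.exists_isMinOn hne hcont
        refine ⟨|Φ yw₀| + |Ψ yw₀|, ?_, fun yw hyw ↦ hmin hyw⟩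
        have hy₀ : yw₀.1 ∈ e.baseSet := hNb hyw₀.1
        have hw₀ : e.symm yw₀.1 yw₀.2 ≠ 0 := by
          intro h0
          have h2 : e.symmL ℝ yw₀.1 yw₀.2 = 0 := by rwa [e.symmL_apply (R := ℝ) hy₀]
          have h3 := congrArg (e.continuousLinearMapAt ℝ yw₀.1) h2
          rw [e.continuousLinearMapAt_symmL hy₀, map_zero] at h3
          have h4 : ‖yw₀.2‖ = 1 := by simpa using hyw₀.2
          rw [h3, norm_zero] at h4
          exact zero_ne_one h4
        rcases eq_or_ne (Φ yw₀) 0 with h0 | h0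
        · have hΨ0 : Ψ yw₀ ≠ 0 := hnd _ (hNW hyw₀.1) _ h0 hw₀
          exact add_pos_of_nonneg_of_pos (abs_nonneg _) (abs_pos.2 hΨ0)
        · exact add_pos_of_pos_of_nonneg (abs_pos.2 h0) (abs_nonneg _)
      · exact ⟨1, one_pos, fun yw hyw ↦ (hne ⟨yw, hyw⟩).elim⟩
    -- the chart norm of a bounded-frequency null vector over `N` is bounded by `B / m`
    have hbd : ∀ p : TangentBundle I M, p.proj ∈ N → g.val p.proj p.2 p.2 = 0 →
        |mvfderiv I τ p.proj p.2| ≤ B → ‖(e p).2‖ ≤ B / m := by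
      intro p hp h0 hB
      have hpe : p.proj ∈ e.baseSet := hNb hp
      have hB0 : 0 ≤ B := (abs_nonneg _).trans hB
      set w : E := (e p).2 with hw_def
      by_cases hw0 : w = 0
      · rw [hw0, norm_zero]
        exact div_nonneg hB0 hm.le
      · have hsym : e.symm p.proj w = p.2 := e.symm_proj_apply p hpe
        have hwpos : 0 < ‖w‖ := norm_pos_iff.2 hw0
        set u : E := ‖w‖⁻¹ • w with hu_def
        have hu : u ∈ sphere (0 : E) 1 := by
          rw [mem_sphere_zero_iff_norm, hu_def, norm_smul, norm_inv, norm_norm,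
            inv_mul_cancel₀ hwpos.ne']
        have h1 : m ≤ |Φ (p.proj, u)| + |Ψ (p.proj, u)| := hmΦΨ _ ⟨hp, hu⟩
        have h2 : Φ (p.proj, u) = 0 := by
          have h3 : Φ (p.proj, w) = g.val p.proj p.2 p.2 := by simp only [hΦ_def, hsym]
          rw [hu_def, hΦsmul _ hpe, h3, h0, mul_zero]
        have h4 : Ψ (p.proj, u) = ‖w‖⁻¹ * mvfderiv I τ p.proj p.2 := by
          have h5 : Ψ (p.proj, w) = mvfderiv I τ p.proj p.2 := by simp only [hΨ_def, hsym]
          rw [hu_def, hΨsmul _ hpe, h5]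
        rw [h2, h4, abs_zero, zero_add, abs_mul, abs_inv, abs_norm] at h1
        have h6 : m * ‖w‖ ≤ B :=
          calc m * ‖w‖ ≤ ‖w‖⁻¹ * |mvfderiv I τ p.proj p.2| * ‖w‖ :=
                mul_le_mul_of_nonneg_right h1 (norm_nonneg _)
            _ = |mvfderiv I τ p.proj p.2| := by field_simp
            _ ≤ B := hB
        rw [le_div_iff₀ hm]
        linarith
    -- the compact set `e⁻¹ (N × closedBall)`
    refine ⟨N, hN, (fun yw : M × E ↦ (TotalSpace.mk' E yw.1 (e.symm yw.1 yw.2) :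
      TangentBundle I M)) '' (N ×ˢ closedBall (0 : E) (B / m)), ?_, ?_⟩
    · exact (hNc.prod (isCompact_closedBall 0 _)).image_of_continuousOn
        (e.continuousOn_symm.mono (prod_mono hNb (subset_univ _)))
    · intro p hp h0 hB
      have hpe : p.proj ∈ e.baseSet := hNb hp
      have hps : p ∈ e.source := e.mem_source.2 hpe
      refine ⟨e p, ⟨?_, ?_⟩, ?_⟩
      · rw [e.coe_fst hps]
        exact hp
      · rw [mem_closedBall, dist_zero_right]
        exact hbd p hp h0 hB
      · have hb : (e p).1 ∈ e.baseSet := by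
          rw [e.coe_fst hps]
          exact hpe
        show TotalSpace.mk (e p).1 (e.symm (e p).1 (e p).2) = p
        rw [e.mk_symm hb, Prod.mk.eta]
        exact e.toOpenPartialHomeomorph.left_inv hps
  -- cover `S` by finitely many such neighbourhoods
  choose N hN 𝒦 h𝒦 hmem using hloc
  obtain ⟨t, ht⟩ := hS.elim_nhds_subcover' N hN
  refine ⟨⋃ x ∈ t, 𝒦 x x.2, t.isCompact_biUnion fun x _ ↦ h𝒦 x x.2, fun p hp h0 hB ↦ ?_⟩
  obtain ⟨x, hx, hpx⟩ := mem_iUnion₂.1 (ht hp)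
  exact mem_iUnion₂.2 ⟨x, hx, hmem x x.2 p hpx h0 hB⟩

/-- **G5 (compactness of bounded-frequency null vectors).**  On the spacetime of a stationary
asymptotically flat black hole `𝓑`: over a compact `S`, the null vectors `k` with `|dτ(k)| ≤ B`,
for a function `τ` which is `C¹` on an open `W ⊇ S` with spacelike level sets there
(`dτ(k) ≠ 0` for null `k ≠ 0`), lie in a compact subset of `TM`.  This is
`exists_isCompact_null_frequency_superset` for the metric of `𝓑`; the carrier, a `4`-manifold, is
locally compact (`Manifold.locallyCompact_of_finiteDimensional`). -/
theorem stub_nullFrequencyCompact :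
    ∀ (𝓑 : StationaryAFBlackHole.{0}) (S W : Set 𝓑.carrier) (τ : 𝓑.carrier → ℝ) (B : ℝ),
      IsCompact S → IsOpen W → S ⊆ W → ContMDiffOn (𝓡 4) 𝓘(ℝ, ℝ) 1 τ W →
      (∀ x ∈ W, ∀ k : TangentSpace (𝓡 4) x, 𝓑.metric.val x k k = 0 → k ≠ 0 →
        mvfderiv (𝓡 4) τ x k ≠ 0) →
      ∃ 𝒦 : Set (TangentBundle (𝓡 4) 𝓑.carrier), IsCompact 𝒦 ∧
        ∀ p : TangentBundle (𝓡 4) 𝓑.carrier, p.proj ∈ S → 𝓑.metric.val p.proj p.2 p.2 = 0 →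
          |mvfderiv (𝓡 4) τ p.proj p.2| ≤ B → p ∈ 𝒦 := by
  intro 𝓑 S W τ B hS hW hSW hτ hnd
  haveI : LocallyCompactSpace 𝓑.carrier :=
    Manifold.locallyCompact_of_finiteDimensional (M := 𝓑.carrier) (𝓡 4)
  exact exists_isCompact_null_frequency_superset 𝓑.metric.toPseudoRiemannianMetric B hS hW hSW
    hτ hnd

end Summit.FinalStateConjecture.FinalStateConjecture.Theorems.ErgoregionBombModT

end
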